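import Literature.MathematicalPhysics.QuantumManyBody.BoseGasFreeProductState
import Literature.MathematicalPhysics.QuantumManyBody.BoseGasProductOrbital

/-!
# `BecFreeGas` (stmt-AtomisticToContinuum-8912), negative side I: zero-flat-mode Dirichlet states

Witnesses for the load-bearing analysis of the free-gas crux `BecFreeGas` of route `BECInfraredBound`
(shared as `FreeGasZeroMode` by `BECStoquasticCensoring`, `BECEqualScatteringTransfer`,
`BECHierarchicalRetention`); disprover seat `refuter-cdisprove-stmt-AtomisticToContinuum-8912-0`.
The crux is TRUE (sorry-free candidate `Cruxes/BecFreeGas/TorusPoincareQuarterCandidate.lean:becFreeGas`);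
these states show which hypothesis carries it (`EnergyCutLoadBearing.lean`):

* `fderiv_prodProfile_single`, `exists_trialState_prodProfile` — coordinate products
  `Ψ(X) = ∏_{(i,k)} G_k(x_{ik})` with direction-dependent unit profiles `G_k ∈ C¹_c((0,L))`: admissible
  bosonic Dirichlet trial states with `energy 0 Ψ = N ∑_k ∫ G_k'²` and, when `∫ G₀ = 0`, occupation of the
  flat mode `φ₀ = L^{-3/2} 1_{Λ_L}` EXACTLY `0` (every slice `x ↦ Ψ(x,Y)` is orthogonal to the constants);
* `exists_oddProfile_deriv` — profiles `g₀ = (h − h(L−·))/√2` (`h` the tree's near-optimal profile of the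
  half box `(0,L/2)`; `∫ g₀ = 0`, `∫ g₀'² ≤ 4(1+η)π²/L²`) and `g` (near-optimal profile of `(0,L)`);
* `exists_trialState_flatMode_zero_energy_le` — for `η > 0`, `L ≥ L₀(η)` and EVERY `N`: a zero-flat-mode
  state of free energy `≤ 6(1+η)π²N/L²`, the `(2,1,1)` level (twice the ground-state energy `3π²N/L²`).

Generalises the single-profile product of `BoseGasFreeProductState.lean` (`exists_freeProductState`).
No route item is concluded here; no definitions are introduced.
-/

noncomputable section

open MeasureTheory Filter Set Topology Real
open scoped ENNReal NNReal ComplexConjugate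

namespace Summit.AtomisticToContinuum.BoseEinsteinCondensation.Theorems.BecFreeGas.Negative

open Literature.MathematicalPhysics.QuantumManyBody.BoseGas

/-! ### The witnesses: coordinate-product states with direction-dependent profiles, one of them odd -/

/-- **Partial derivatives of a coordinate product with direction-dependent profiles.** For `C¹`
profiles `G k`, `∂_{ik} ∏_{(j,m)} G_m(x_{jm}) = G_k'(x_{ik}) ∏_{(j,m) ≠ (i,k)} G_m(x_{jm})`. [folklore] -/
theorem fderiv_prodProfile_single {N : ℕ} {G : Fin 3 → ℝ → ℝ} (hG : ∀ k, ContDiff ℝ 1 (G k))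
    (X : Config N) (i : Fin N) (k : Fin 3) :
    fderiv ℝ (fun X : Config N => ∏ p : Fin N × Fin 3, G p.2 (X p.1 p.2)) X
        (Pi.single i (EuclideanSpace.single k (1 : ℝ))) =
      deriv (G k) (X i k) * ∏ p ∈ Finset.univ.erase (i, k), G p.2 (X p.1 p.2) := by
  classical
  set e : Fin N × Fin 3 → (Config N →L[ℝ] ℝ) := fun p =>
    ((EuclideanSpace.proj p.2).comp (ContinuousLinearMap.proj (R := ℝ) p.1) : Config N →L[ℝ] ℝ) with he
  have hfac : ∀ p : Fin N × Fin 3, HasFDerivAt (fun X : Config N => G p.2 (X p.1 p.2))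
      (deriv (G p.2) (X p.1 p.2) • e p) X := fun p =>
    (((hG p.2).differentiable one_ne_zero) (X p.1 p.2)).hasDerivAt.comp_hasFDerivAt X (e p).hasFDerivAt
  have hprod := HasFDerivAt.finsetProd (u := Finset.univ) fun p _ => hfac p
  rw [hprod.fderiv]
  have hep : ∀ p : Fin N × Fin 3, e p (Pi.single i (EuclideanSpace.single k (1 : ℝ))) =
      if p = (i, k) then 1 else 0 := fun p => coordCLM_single p i k
  simp only [FunLike.coe_sum, Finset.sum_apply, FunLike.coe_smul,
    Pi.smul_apply, hep, smul_eq_mul, mul_ite, mul_one, mul_zero, Finset.sum_ite_eq',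
    Finset.mem_univ, if_true]
  exact mul_comm _ _

/-- **Coordinate-product trial states with direction-dependent profiles.** For `C¹` unit profiles
`G₀, G₁, G₂ ∈ C¹_c((0,L))` with `∫ G₀ = 0`, the product `Ψ(X) = ∏_{(i,k)} G_k(x_{ik})` is an admissible
bosonic Dirichlet state of `Λ_L` with flat-mode occupation `⟨φ₀, γ_Ψ φ₀⟩ = 0` and free energy
`energy 0 Ψ = N ∑_k ∫ G_k'²`. [folklore] -/
theorem exists_trialState_prodProfile (N : ℕ) {L : ℝ} (G : Fin 3 → ℝ → ℝ)
    (hGc : ∀ k, ContDiff ℝ 1 (G k)) (hGz : ∀ k t, t ∉ Ioo 0 L → G k t = 0)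
    (hGd : ∀ k, Continuous (deriv (G k)))
    (hG1 : ∀ k, ∫ t, G k t ^ 2 = 1) (hG0 : ∫ t, G 0 t = 0) :
    ∃ Ψ : TrialState N L,
      occupation N ((box L).indicator fun _ => ((Real.sqrt (L ^ 3))⁻¹ : ℂ)) Ψ.ψ = 0 ∧
      energy 0 Ψ = N * ∑ k : Fin 3, ENNReal.ofReal (∫ t, deriv (G k) t ^ 2) := by
  classical
  have hGs : ∀ k, HasCompactSupport (G k) := fun k =>
    HasCompactSupport.intro isCompact_Icc fun t ht => hGz k t fun h => ht (Ioo_subset_Icc_self h)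
  have hGi : ∀ k, Integrable (G k) := fun k => (hGc k).continuous.integrable_of_hasCompactSupport (hGs k)
  have hGi2 : ∀ k, Integrable fun t => G k t ^ 2 := fun k => by
    have h : Integrable (fun t => G k t * G k t) :=
      ((hGc k).continuous.mul (hGc k).continuous).integrable_of_hasCompactSupport (hGs k).mul_right
    simpa [pow_two] using h
  have hGd2 : ∀ k, Integrable fun t => deriv (G k) t ^ 2 := fun k => by
    have h : Integrable (fun t => deriv (G k) t * deriv (G k) t) :=
      ((hGd k).mul (hGd k)).integrable_of_hasCompactSupport (hGs k).deriv.mul_right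
    simpa [pow_two] using h
  -- the product wave function
  set F : Config N → ℝ := fun X => ∏ p : Fin N × Fin 3, G p.2 (X p.1 p.2) with hF
  have hFc : ContDiff ℝ 1 F := contDiff_prod fun p _ =>
    (hGc p.2).comp ((EuclideanSpace.proj p.2).comp (ContinuousLinearMap.proj (R := ℝ) p.1) :
      Config N →L[ℝ] ℝ).contDiff
  set ψ : Config N → ℂ := fun X => ((F X : ℝ) : ℂ) with hψ
  have hψc : ContDiff ℝ 1 ψ := Complex.ofRealCLM.contDiff.comp hFc
  have hnorm : ∫⁻ X, ((‖ψ X‖₊ : ℝ≥0∞)) ^ 2 = 1 := by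
    have hpt : ∀ X, ((‖ψ X‖₊ : ℝ≥0∞)) ^ 2 =
        ENNReal.ofReal (∏ p : Fin N × Fin 3, G p.2 (X p.1 p.2) ^ 2) := by
      intro X
      rw [ennnorm_sq_eq_ofReal, hψ]
      simp only [Complex.norm_real, Real.norm_eq_abs, sq_abs, hF, ← Finset.prod_pow]
    simp_rw [hpt]
    rw [lintegral_ofReal_prod_coord (fun p t => G p.2 t ^ 2) (fun _ _ => sq_nonneg _) fun p => hGi2 p.2]
    simp [hG1]
  let Ψ : TrialState N L :=
    { ψ := ψ
      contDiff := hψc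
      eq_zero := fun X hX => by
        obtain ⟨i, k, hik⟩ : ∃ i k, X i k ∉ Ioo (0 : ℝ) L := by
          by_contra hall; push Not at hall; exact hX fun i k => hall i k
        have : F X = 0 := Finset.prod_eq_zero (Finset.mem_univ (i, k)) (hGz _ _ hik)
        simp [hψ, this]
      symm := fun σ X => by
        simp only [hψ, hF, Function.comp_apply]
        congr 1
        exact Equiv.prod_comp (σ.prodCongr (Equiv.refl (Fin 3))) (fun q : Fin N × Fin 3 => G q.2 (X q.1 q.2))
      norm_eq := hnorm }
  have hΨψ : Ψ.ψ = ψ := rfl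
  refine ⟨Ψ, ?_, ?_⟩
  · -- the one-body integral against the flat mode vanishes: `∫ G₀ · ∫ G₁ · ∫ G₂ = 0`
    have hone : ∫ x : Space, G 0 (x 0) * G 1 (x 1) * G 2 (x 2) = 0 := by
      rw [ProductOrbital.integral_coord_prod, hG0, zero_mul, zero_mul]
    have hvan : ∀ x : Space, x ∉ box L → G 0 (x 0) * G 1 (x 1) * G 2 (x 2) = 0 := by
      intro x hx
      obtain ⟨k, hk⟩ : ∃ k, x k ∉ Ioo (0 : ℝ) L := by
        by_contra hall; push Not at hall; exact hx fun k => hall k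
      have : ∏ j : Fin 3, G j (x j) = 0 := Finset.prod_eq_zero (Finset.mem_univ k) (hGz k _ hk)
      simpa [Fin.prod_univ_three] using this
    cases N with
    | zero => rfl
    | succ n =>
      have hslice : ∀ (x : Space) (Y : Config n), ψ (Matrix.vecCons x Y) =
          ((G 0 (x 0) * G 1 (x 1) * G 2 (x 2) : ℝ) : ℂ) *
            ((∏ p : Fin n × Fin 3, G p.2 (Y p.1 p.2) : ℝ) : ℂ) := by
        intro x Y
        simp only [hψ, hF]
        rw [← Complex.ofReal_mul]
        congr 1
        rw [Fintype.prod_prod_type, Fintype.prod_prod_type, Fin.prod_univ_succ]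
        simp only [Matrix.cons_val_zero, Matrix.cons_val_succ, Fin.prod_univ_three]
      have hinner : ∀ Y : Config n,
          ∫ x, conj (((box L).indicator fun _ => ((Real.sqrt (L ^ 3))⁻¹ : ℂ)) x) * ψ (Matrix.vecCons x Y) = 0 := by
        intro Y
        have hpt : ∀ x, conj (((box L).indicator fun _ => ((Real.sqrt (L ^ 3))⁻¹ : ℂ)) x) *
            ψ (Matrix.vecCons x Y) =
            ((G 0 (x 0) * G 1 (x 1) * G 2 (x 2) : ℝ) : ℂ) *
              ((((Real.sqrt (L ^ 3))⁻¹ : ℝ) : ℂ) * ((∏ p : Fin n × Fin 3, G p.2 (Y p.1 p.2) : ℝ) : ℂ)) := by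
          intro x
          rw [hslice]
          by_cases hx : x ∈ box L
          · rw [Set.indicator_of_mem hx, ← Complex.ofReal_inv, Complex.conj_ofReal]
            ring
          · rw [Set.indicator_of_notMem hx, map_zero, zero_mul, hvan x hx, Complex.ofReal_zero, zero_mul]
        simp_rw [hpt]
        rw [integral_mul_const, integral_complex_ofReal, hone, Complex.ofReal_zero, zero_mul]
      unfold occupation
      rw [hΨψ]
      simp_rw [hinner]
      simp
  · -- the kinetic energy of the product: `N ∑_k ∫ G_k'²`
    have hderiv : ∀ (X : Config N) (i : Fin N) (k : Fin 3),
        ((‖fderiv ℝ ψ X (Pi.single i (EuclideanSpace.single k (1 : ℝ)))‖₊ : ℝ≥0∞)) ^ 2 =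
          ENNReal.ofReal (∏ p : Fin N × Fin 3,
            (if p = (i, k) then deriv (G p.2) (X p.1 p.2) ^ 2 else G p.2 (X p.1 p.2) ^ 2)) := by
      intro X i k
      have hFd : HasFDerivAt F (fderiv ℝ F X) X := (hFc.differentiable one_ne_zero X).hasFDerivAt
      have hψd : HasFDerivAt ψ (Complex.ofRealCLM.comp (fderiv ℝ F X)) X :=
        Complex.ofRealCLM.hasFDerivAt.comp X hFd
      rw [hψd.fderiv, ContinuousLinearMap.comp_apply, Complex.ofRealCLM_apply, hF,
        fderiv_prodProfile_single hGc X i k, ennnorm_sq_eq_ofReal, Complex.norm_real, Real.norm_eq_abs,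
        sq_abs]
      congr 1
      rw [mul_pow, ← Finset.prod_pow, ← Finset.mul_prod_erase Finset.univ _ (Finset.mem_univ (i, k))]
      simp only [if_true]
      congr 1
      exact Finset.prod_congr rfl fun p hp => by rw [if_neg (Finset.ne_of_mem_erase hp)]
    have hkin : ∫⁻ X, kineticDensity ψ X = N * ∑ k : Fin 3, ENNReal.ofReal (∫ t, deriv (G k) t ^ 2) := by
      unfold kineticDensity
      rw [lintegral_finsetSum Finset.univ fun i _ => Finset.measurable_sum Finset.univ fun k _ =>
        measurable_ennnormSq_fderiv_apply hψc _]
      have hik : ∀ (i : Fin N) (k : Fin 3),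
          ∫⁻ X, ((‖fderiv ℝ ψ X (Pi.single i (EuclideanSpace.single k (1 : ℝ)))‖₊ : ℝ≥0∞)) ^ 2 =
            ENNReal.ofReal (∫ t, deriv (G k) t ^ 2) := by
        intro i k
        simp_rw [hderiv]
        rw [lintegral_ofReal_prod_coord
          (fun p t => if p = (i, k) then deriv (G p.2) t ^ 2 else G p.2 t ^ 2)
          (fun p t => by split_ifs <;> positivity) (fun p => by
            by_cases hp : p = (i, k)
            · subst hp; simp only [if_true]; exact hGd2 k
            · simp only [hp, if_false]; exact hGi2 p.2)]
        congr 1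
        have : ∀ p : Fin N × Fin 3, (∫ t, (if p = (i, k) then deriv (G p.2) t ^ 2 else G p.2 t ^ 2)) =
            if p = (i, k) then ∫ t, deriv (G k) t ^ 2 else 1 := by
          intro p
          by_cases hp : p = (i, k)
          · subst hp; simp
          · simp [hp, hG1]
        simp_rw [this]
        rw [Finset.prod_ite_eq']; simp
      simp_rw [lintegral_finsetSum Finset.univ fun k _ => measurable_ennnormSq_fderiv_apply hψc _, hik]
      simp only [Finset.sum_const, Finset.card_univ, Fintype.card_fin, nsmul_eq_mul]
    have hint0 : ∀ X : Config N, interaction 0 X = 0 := fun X => by simp [interaction]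
    calc energy 0 Ψ = ∫⁻ X, kineticDensity ψ X := by
          simp only [energy, hint0, zero_mul, add_zero]; rfl
      _ = _ := hkin


/-- **Unit profiles with controlled Dirichlet energy, one of them odd.** For `η > 0` and `L ≥ L₀(η)`
there are `g₀, g ∈ C¹_c((0,L))` with `∫ g₀² = ∫ g² = 1`, `∫ g₀ = 0`, `∫ g₀'² ≤ 4(π/L)²(1+η)` (the
`n = 2` level) and `∫ g'² ≤ (π/L)²(1+η)` (the ground level): `g` is the tree's near-optimal profile of
`(0,L)` and `g₀ = (h − h(L−·))/√2` with `h` the near-optimal profile of the half box `(0,L/2)`. [folklore] -/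
theorem exists_oddProfile_deriv {η : ℝ} (hη : 0 < η) :
    ∃ L₀ : ℝ, 0 < L₀ ∧ ∀ L : ℝ, L₀ ≤ L → ∃ g₀ g : ℝ → ℝ,
      ContDiff ℝ 1 g₀ ∧ ContDiff ℝ 1 g ∧
      (∀ t, t ∉ Ioo 0 L → g₀ t = 0) ∧ (∀ t, t ∉ Ioo 0 L → g t = 0) ∧
      Continuous (deriv g₀) ∧ Continuous (deriv g) ∧
      (∫ t, g₀ t ^ 2 = 1) ∧ (∫ t, g t ^ 2 = 1) ∧ (∫ t, g₀ t = 0) ∧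
      (∫ t, deriv g₀ t ^ 2 ≤ 4 * (π / L) ^ 2 * (1 + η)) ∧
      (∫ t, deriv g t ^ 2 ≤ (π / L) ^ 2 * (1 + η)) := by
  obtain ⟨L₁, hL₁, H⟩ := exists_nearOptimal_profile hη
  refine ⟨2 * L₁, by positivity, fun L hL => ?_⟩
  have hL2 : L₁ ≤ L / 2 := by linarith
  have hL1 : L₁ ≤ L := by linarith
  -- the full-box profile `g` and the half-box profile `h`
  obtain ⟨g, hgc, -, hgz, hgd, hg1, hgJ⟩ := H L hL1
  obtain ⟨h, hhc, hhs, hhz, hhd, hh1, hhJ⟩ := H (L / 2) hL2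
  have hhz' : ∀ t, t ∉ Ioo 0 L → h t = 0 := fun t ht =>
    hhz t fun h' => ht ⟨h'.1, h'.2.trans (by linarith)⟩
  have hhmz : ∀ t, t ∉ Ioo 0 L → h (L - t) = 0 := by
    intro t ht
    refine hhz _ fun h' => ht ⟨?_, ?_⟩
    · by_contra h0
      push Not at h0
      linarith [h'.2]
    · by_contra h0
      push Not at h0
      linarith [h'.1]
  have hprod : ∀ t, h t * h (L - t) = 0 := by
    intro t
    by_cases ht : t < L / 2
    · rw [hhz (L - t) fun h' => by linarith [h'.2], mul_zero]
    · rw [hhz t fun h' => ht h'.2, zero_mul]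
  -- `h'` vanishes on `[L/2, ∞)` (locally constant there, and continuous at `L/2`)
  have hdz' : ∀ t, L / 2 < t → deriv h t = 0 := fun t ht => by
    have : h =ᶠ[𝓝 t] fun _ => 0 := by
      filter_upwards [Ioi_mem_nhds ht] with s hs
      exact hhz s fun h' => lt_irrefl _ (h'.2.trans hs)
    rw [this.deriv_eq, deriv_const]
  have hdzL : deriv h (L / 2) = 0 := by
    have h1 : Tendsto (deriv h) (𝓝[>] (L / 2)) (𝓝 (deriv h (L / 2))) :=
      hhd.continuousAt.tendsto.mono_left nhdsWithin_le_nhds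
    have h2 : Tendsto (deriv h) (𝓝[>] (L / 2)) (𝓝 0) := by
      refine tendsto_const_nhds.congr' ?_
      filter_upwards [self_mem_nhdsWithin] with s hs
      exact (hdz' s hs).symm
    exact tendsto_nhds_unique h1 h2
  have hdprod : ∀ t, deriv h t * deriv h (L - t) = 0 := by
    intro t
    by_cases ht : L / 2 ≤ t
    · rcases ht.eq_or_lt with ht | ht
      · rw [← ht, hdzL, zero_mul]
      · rw [hdz' t ht, zero_mul]
    · push Not at ht
      rw [hdz' (L - t) (by linarith), mul_zero]
  have hhi : Integrable h := hhc.continuous.integrable_of_hasCompactSupport hhs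
  have hhi2 : Integrable fun t => h t ^ 2 := by
    have h' : Integrable (fun t => h t * h t) :=
      (hhc.continuous.mul hhc.continuous).integrable_of_hasCompactSupport hhs.mul_right
    simpa [pow_two] using h'
  have hhd2 : Integrable fun t => deriv h t ^ 2 := by
    have h' : Integrable (fun t => deriv h t * deriv h t) :=
      (hhd.mul hhd).integrable_of_hasCompactSupport hhs.deriv.mul_right
    simpa [pow_two] using h'
  -- the odd profile
  set g₀ : ℝ → ℝ := fun t => (h t - h (L - t)) / Real.sqrt 2 with hg₀
  have hg₀c : ContDiff ℝ 1 g₀ :=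
    (hhc.sub (hhc.comp (contDiff_const.sub contDiff_id))).div_const _
  have hg₀z : ∀ t, t ∉ Ioo 0 L → g₀ t = 0 := fun t ht => by
    simp only [hg₀, hhz' t ht, hhmz t ht, sub_zero, zero_div]
  have hderiv : ∀ t, HasDerivAt g₀ ((deriv h t + deriv h (L - t)) / Real.sqrt 2) t := by
    intro t
    have h1 : HasDerivAt h (deriv h t) t := ((hhc.differentiable one_ne_zero) t).hasDerivAt
    have h2 : HasDerivAt (fun s => h (L - s)) (deriv h (L - t) * (0 - 1)) t :=
      (((hhc.differentiable one_ne_zero) (L - t)).hasDerivAt).comp t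
        ((hasDerivAt_const t L).sub (hasDerivAt_id t))
    have h3 := (h1.sub h2).div_const (Real.sqrt 2)
    have heq : (deriv h t - deriv h (L - t) * (0 - 1)) / Real.sqrt 2 =
        (deriv h t + deriv h (L - t)) / Real.sqrt 2 := by ring
    rw [heq] at h3
    exact h3
  have hg₀d_eq : deriv g₀ = fun t => (deriv h t + deriv h (L - t)) / Real.sqrt 2 :=
    funext fun t => (hderiv t).deriv
  have hg₀d : Continuous (deriv g₀) := by
    rw [hg₀d_eq]
    exact (hhd.add (hhd.comp (continuous_const.sub continuous_id))).div_const _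
  have h2sq : Real.sqrt 2 ^ 2 = 2 := Real.sq_sqrt (by norm_num)
  have hsq : ∀ t, g₀ t ^ 2 = (h t ^ 2 + h (L - t) ^ 2) / 2 := by
    intro t
    simp only [hg₀, div_pow, h2sq]
    congr 1
    nlinarith [hprod t]
  have hdsq : ∀ t, deriv g₀ t ^ 2 = (deriv h t ^ 2 + deriv h (L - t) ^ 2) / 2 := by
    intro t
    simp only [hg₀d_eq, div_pow, h2sq]
    congr 1
    nlinarith [hdprod t]
  refine ⟨g₀, g, hg₀c, hgc, hg₀z, hgz, hg₀d, hgd, ?_, hg1, ?_, ?_, hgJ⟩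
  · simp_rw [hsq]
    rw [integral_div, integral_add hhi2 (hhi2.comp_sub_left L),
      integral_sub_left_eq_self (fun t => h t ^ 2) volume L, hh1]
    norm_num
  · simp only [hg₀]
    rw [integral_div, integral_sub hhi (hhi.comp_sub_left L), integral_sub_left_eq_self h volume L,
      sub_self, zero_div]
  · simp_rw [hdsq]
    rw [integral_div, integral_add hhd2 (hhd2.comp_sub_left L),
      integral_sub_left_eq_self (fun t => deriv h t ^ 2) volume L]
    have h4 : (π / (L / 2)) ^ 2 = 4 * (π / L) ^ 2 := by ring
    rw [h4] at hhJ
    linarith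

/-- **Zero-flat-mode states at the `(2,1,1)` level.** For `η > 0`, `L ≥ L₀(η)` and every `N` there is an
admissible Dirichlet state of `Λ_L` with flat-mode occupation EXACTLY `0` and free energy
`≤ 6(1+η)π²N/L²` — one quantum `3π²/L²` per particle above the ground level `3π²N/L²`. [folklore] -/
theorem exists_trialState_flatMode_zero_energy_le {η : ℝ} (hη : 0 < η) :
    ∃ L₀ : ℝ, 0 < L₀ ∧ ∀ L : ℝ, L₀ ≤ L → ∀ N : ℕ, ∃ Ψ : TrialState N L,
      occupation N ((box L).indicator fun _ => ((Real.sqrt (L ^ 3))⁻¹ : ℂ)) Ψ.ψ = 0 ∧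
      energy 0 Ψ ≤ ENNReal.ofReal (6 * (1 + η) * π ^ 2 * N / L ^ 2) := by
  obtain ⟨L₀, hL₀, H⟩ := exists_oddProfile_deriv hη
  refine ⟨L₀, hL₀, fun L hL N => ?_⟩
  have hLpos : 0 < L := hL₀.trans_le hL
  obtain ⟨g₀, g, hg₀c, hgc, hg₀z, hgz, hg₀d, hgd, hg₀1, hg1, hg₀0, hg₀J, hgJ⟩ := H L hL
  classical
  set G : Fin 3 → ℝ → ℝ := fun k => if k = 0 then g₀ else g with hG
  obtain ⟨Ψ, hocc, hE⟩ := exists_trialState_prodProfile N G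
    (fun k => by simp only [hG]; split_ifs; exacts [hg₀c, hgc])
    (fun k t ht => by simp only [hG]; split_ifs; exacts [hg₀z t ht, hgz t ht])
    (fun k => by simp only [hG]; split_ifs; exacts [hg₀d, hgd])
    (fun k => by simp only [hG]; split_ifs; exacts [hg₀1, hg1])
    (by simp only [hG, if_true]; exact hg₀0)
  refine ⟨Ψ, hocc, ?_⟩
  rw [hE]
  have h10 : (1 : Fin 3) ≠ 0 := by decide
  have h20 : (2 : Fin 3) ≠ 0 := by decide
  have hsum : ∑ k : Fin 3, ENNReal.ofReal (∫ t, deriv (G k) t ^ 2) ≤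
      ENNReal.ofReal (6 * (1 + η) * (π / L) ^ 2) := by
    rw [Fin.sum_univ_three]
    simp only [hG, if_true, h10, h20, if_false]
    calc ENNReal.ofReal (∫ t, deriv g₀ t ^ 2) + ENNReal.ofReal (∫ t, deriv g t ^ 2) +
          ENNReal.ofReal (∫ t, deriv g t ^ 2)
        ≤ ENNReal.ofReal (4 * (π / L) ^ 2 * (1 + η)) + ENNReal.ofReal ((π / L) ^ 2 * (1 + η)) +
          ENNReal.ofReal ((π / L) ^ 2 * (1 + η)) := by gcongr
      _ = ENNReal.ofReal (6 * (1 + η) * (π / L) ^ 2) := by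
          rw [← ENNReal.ofReal_add (by positivity) (by positivity),
            ← ENNReal.ofReal_add (by positivity) (by positivity)]
          congr 1; ring
  calc (N : ℝ≥0∞) * ∑ k : Fin 3, ENNReal.ofReal (∫ t, deriv (G k) t ^ 2)
      ≤ (N : ℝ≥0∞) * ENNReal.ofReal (6 * (1 + η) * (π / L) ^ 2) := by gcongr
    _ = ENNReal.ofReal (6 * (1 + η) * π ^ 2 * N / L ^ 2) := by
        rw [← ENNReal.ofReal_natCast, ← ENNReal.ofReal_mul (Nat.cast_nonneg _)]
        congr 1
        rw [div_pow]
        field_simp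

end Summit.AtomisticToContinuum.BoseEinsteinCondensation.Theorems.BecFreeGas.Negative

end
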